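import Summits.Schanuel.Schanuel.Theses.BakerOverExpField
import Summits.Schanuel.Schanuel.Theorems.RigidCoreSchanuelOnLogFreeCoreSectorGlue
import Literature.NumberTheory.Transcendental.RankOneGridTrdeg

/-!
# Disproof of `BakerOverL` (crux stmt-Schanuel-19261, route BakerOverExpField) — findings

Birth-vetting crux attack (refuter, 2026-08-17).  VERDICT: survives; no unconditional refutation is
to be expected, because the crux is a KERNEL-CHECKED CONSEQUENCE OF THE SUMMIT, pointwise in `z`:

* `bakerOverL_at_of_schanuel_at` : `S(z) → X1(z)` — Schanuel's inequality at `z` gives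
  `n + 1 ≤ dim_L span_L(1, z) + trdeg ℚ(e^z)` at the same `z` (tower law
  `trdeg ℚ(z,e^z) = trdeg ℚ(e^z) + trdeg_K K(z)`, base change `trdeg_K K(z) ≤ trdeg_L L(z)` for
  `L = K^alg ∩ ℂ`, and the affine bound `trdeg_L L(z) + 1 ≤ dim_L span_L(1, z)`); globally
  `Schanuel → BakerOverL`, recorded as the contrapositive `not_schanuel_of_not_bakerOverL` (the
  positive global form is deliberately not declared, so that no audit mistakes it for a proof).
  Hence a refutation of the crux is a disproof of `Schanuel`; in particular the statement is not false
  for a junk / degenerate reason (every instance follows from the audited summit's instance).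
* degenerate instance `n = 0` holds outright (`bakerOverL_zero`); `n = 1` is Hermite–Lindemann-shaped
  (`z ≠ 0`, `e^z ∈ ℚ̄ ⇒ z ∉ ℚ̄`), `b = 0` is Baker (tree: `baker_expField_logLayer`).
* (a) LOAD-BEARING: `bakerOverL_false_without_linIndep` — drop `LinearIndependent ℚ z` and the
  statement fails at `z = (1, 1)` (`d = 1`, `b = trdeg ℚ(e) ≤ 1`, `3 ≰ 2`).
* (b) TIGHTNESS (informal, not formalised here): at `z = (1)` one has `d = 1`, `b = 1` (e is
  transcendental), so `n + 1 = d + b`: the inequality cannot be improved by a constant.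
* (c) COSTUME PROBE `X1 → S`: `exact?` / `aesop` fail (Scratch, 2026-08-17); informally the b = 1
  layer at `(1, iπ)` is exactly `e ⊥ π` (no linear gain at that tuple), but no cheap derivation of
  `S` from `X1` exists: the monomial trick (apply `X1` to a `ℚ`-basis of monomials `z^α`, `|α| ≤ D`)
  only yields "few `L`-algebraically independent coordinates ⇒ the new exponentials `e^{z^α}` are
  highly independent", not `S(z)`; so `X1` is not shown equivalent to `S` (planner's kill criterion
  NOT triggered by cheap means).
* cheap tactics on the crux (`simp`, `aesop`, `norm_num`, `positivity`, `exact?`) all fail; `simp`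
  normal form of the goal is `↑n < ↑d + b`.

Everything below is proved (axioms: propext, Classical.choice, Quot.sound); no `sorry`.
-/

set_option linter.dupNamespace false

open IntermediateField Complex Set Function Cardinal
open Algebra (trdeg)
open Summit.Schanuel.Schanuel.Theorems.RigidCore.SectorGlue (faithfulSMul_of_field trdeg_mono)
open Literature.NumberTheory.Transcendental (trdeg_adjoin_le_mk)

namespace Summit.Schanuel.Schanuel.Cruxes.BakerOverL.Disproof

/-! ### Tower-law bookkeeping -/

/-- Tower law along `K ≤ K(S) ≤ K(S ∪ T)` (equality). [folklore] -/
theorem trdeg_adjoin_union_eq_add (K : Type) [Field K] [Algebra K ℂ] (S T : Set ℂ) :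
    trdeg K (adjoin K (S ∪ T)) =
      trdeg K (adjoin K S) + trdeg (adjoin K S) (adjoin (adjoin K S) T) := by
  haveI := faithfulSMul_of_field K (adjoin K S)
  haveI := faithfulSMul_of_field (adjoin K S) (adjoin (adjoin K S) T)
  rw [trdeg_add_eq K (adjoin K S), ← (equivOfEq (adjoin_adjoin_left K S T)).trdeg_eq]; rfl

/-- Base change to the algebraic closure does not decrease the transcendence degree generated by a
set: `trdeg_K K(S) ≤ trdeg_L L(S)` for `L = K^alg ∩ ℂ`. [folklore] -/
theorem trdeg_adjoin_le_algebraicClosure_base (K : Type) [Field K] [Algebra K ℂ] (S : Set ℂ) :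
    trdeg K (adjoin K S) ≤
      trdeg (algebraicClosure K ℂ) (adjoin (algebraicClosure K ℂ) S) := by
  haveI := faithfulSMul_of_field K (algebraicClosure K ℂ)
  haveI := faithfulSMul_of_field (algebraicClosure K ℂ) (adjoin (algebraicClosure K ℂ) S)
  refine (trdeg_mono (show adjoin K S ≤ (adjoin (algebraicClosure K ℂ) S).restrictScalars K from
    adjoin_le_iff.2 fun x hx => (mem_restrictScalars K).2
      (subset_adjoin (algebraicClosure K ℂ) S hx))).trans_eq ?_
  change trdeg K (adjoin (algebraicClosure K ℂ) S) = _
  rw [← trdeg_add_eq K (algebraicClosure K ℂ), trdeg_eq_zero, zero_add]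

/-- The affine bound: `trdeg_L L(S) + 1 ≤ dim_L span_L ({1} ∪ S)` for finite `S ⊆ ℂ`
(extend `{1}` to an `L`-basis `b ⊆ {1} ∪ S` of the span; `S ⊆ L(b ∖ {1})`). [folklore] -/
theorem trdeg_adjoin_add_one_le_finrank_span (L : Type) [Field L] [Algebra L ℂ] (S : Set ℂ)
    (hS : S.Finite) :
    trdeg L (adjoin L S) + 1 ≤
      (Module.finrank L (Submodule.span L (insert (1 : ℂ) S)) : Cardinal) := by
  have h1 : LinearIndepOn L id ({1} : Set ℂ) := LinearIndepOn.singleton one_ne_zero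
  have hst : ({1} : Set ℂ) ⊆ insert 1 S := singleton_subset_iff.2 (mem_insert 1 S)
  have h1b : (1 : ℂ) ∈ h1.extend hst := h1.subset_extend hst (mem_singleton 1)
  have hspan : insert 1 S ⊆ (Submodule.span L (h1.extend hst) : Set ℂ) :=
    h1.subset_span_extend hst
  have hbli : LinearIndepOn L id (h1.extend hst) := h1.linearIndepOn_extend hst
  have hSadj : S ⊆ (adjoin L (h1.extend hst \ {1}) : Set ℂ) := by
    intro x hx
    have hle : Submodule.span L (h1.extend hst) ≤
        Subalgebra.toSubmodule (adjoin L (h1.extend hst \ {1})).toSubalgebra := by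
      refine Submodule.span_le.2 fun y hy => ?_
      rcases eq_or_ne y 1 with rfl | hy1
      · exact show (1 : ℂ) ∈ adjoin L (h1.extend hst \ {1}) from one_mem _
      · exact show y ∈ adjoin L (h1.extend hst \ {1}) from subset_adjoin L _ ⟨hy, hy1⟩
    exact hle (hspan (mem_insert_of_mem 1 hx))
  haveI : Module.Finite L (Submodule.span L (insert (1 : ℂ) S)) :=
    Module.Finite.span_of_finite L (hS.insert 1)
  calc trdeg L (adjoin L S) + 1 ≤ trdeg L (adjoin L (h1.extend hst \ {1})) + 1 :=
        add_le_add (trdeg_mono (adjoin_le_iff.2 hSadj)) le_rfl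
    _ ≤ #(h1.extend hst \ {1} : Set ℂ) + 1 := add_le_add (trdeg_adjoin_le_mk _) le_rfl
    _ = #(h1.extend hst \ {1} : Set ℂ) + #({1} : Set ℂ) := by rw [Cardinal.mk_singleton]
    _ = #(h1.extend hst) := Cardinal.mk_sdiff_add_mk (singleton_subset_iff.2 h1b)
    _ = Module.rank L (Submodule.span L (h1.extend hst)) := (rank_span_set hbli).symm
    _ = Module.rank L (Submodule.span L (insert (1 : ℂ) S)) := by
        rw [h1.span_extend_eq_span hst]
    _ = (Module.finrank L (Submodule.span L (insert (1 : ℂ) S)) : Cardinal) :=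
        (Module.finrank_eq_rank _ _).symm

/-! ### `S(z) → X1(z)`: the crux is a consequence of the summit -/

/-- **Pointwise certificate.** Schanuel's inequality at `z` implies the crux `BakerOverL` at `z`:
`n ≤ trdeg ℚ(z, e^z) = trdeg ℚ(e^z) + trdeg_K K(z) ≤ b + trdeg_L L(z) ≤ b + (d - 1)`. [folklore] -/
theorem bakerOverL_at_of_schanuel_at {n : ℕ} (z : Fin n → ℂ)
    (hS : (n : Cardinal) ≤
      trdeg ℚ (adjoin ℚ (range z ∪ range (Complex.exp ∘ z)))) :
    ((n + 1 : ℕ) : Cardinal) ≤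
      (Module.finrank (algebraicClosure (adjoin ℚ (range (Complex.exp ∘ z))) ℂ)
        (Submodule.span (algebraicClosure (adjoin ℚ (range (Complex.exp ∘ z))) ℂ)
          (insert (1 : ℂ) (range z))) : Cardinal) +
      trdeg ℚ (adjoin ℚ (range (Complex.exp ∘ z))) := by
  have h2 : trdeg ℚ (adjoin ℚ (range z ∪ range (Complex.exp ∘ z))) =
      trdeg ℚ (adjoin ℚ (range (Complex.exp ∘ z))) +
        trdeg (adjoin ℚ (range (Complex.exp ∘ z)))
          (adjoin (adjoin ℚ (range (Complex.exp ∘ z))) (range z)) := by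
    rw [union_comm]; exact trdeg_adjoin_union_eq_add ℚ _ _
  have h3 := trdeg_adjoin_le_algebraicClosure_base (adjoin ℚ (range (Complex.exp ∘ z))) (range z)
  have h4 := trdeg_adjoin_add_one_le_finrank_span
    (algebraicClosure (adjoin ℚ (range (Complex.exp ∘ z))) ℂ) (range z) (finite_range z)
  rw [Nat.cast_succ, add_comm (Module.finrank _ _ : Cardinal)]
  calc (n : Cardinal) + 1
      ≤ (trdeg ℚ (adjoin ℚ (range (Complex.exp ∘ z))) +
          trdeg (algebraicClosure (adjoin ℚ (range (Complex.exp ∘ z))) ℂ)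
            (adjoin (algebraicClosure (adjoin ℚ (range (Complex.exp ∘ z))) ℂ) (range z))) + 1 :=
        add_le_add ((hS.trans_eq h2).trans (add_le_add le_rfl h3)) le_rfl
    _ = trdeg ℚ (adjoin ℚ (range (Complex.exp ∘ z))) +
          (trdeg (algebraicClosure (adjoin ℚ (range (Complex.exp ∘ z))) ℂ)
            (adjoin (algebraicClosure (adjoin ℚ (range (Complex.exp ∘ z))) ℂ) (range z)) + 1) :=
        add_assoc _ _ _
    _ ≤ _ := add_le_add le_rfl h4

/-- Contrapositive: a refutation of the crux would refute the summit. [folklore] -/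
theorem not_schanuel_of_not_bakerOverL
    (h : ¬ Summit.Schanuel.Schanuel.Theses.BakerOverExpField.BakerOverL) : ¬ _root_.Schanuel :=
  fun hS => h fun _n z hz => bakerOverL_at_of_schanuel_at z (hS _ z hz)

/-- Degenerate instance `n = 0` holds outright (`S` at `n = 0` is `0 ≤ trdeg`). [folklore] -/
theorem bakerOverL_zero (z : Fin 0 → ℂ) :
    ((0 + 1 : ℕ) : Cardinal) ≤
      (Module.finrank (algebraicClosure (adjoin ℚ (range (Complex.exp ∘ z))) ℂ)
        (Submodule.span (algebraicClosure (adjoin ℚ (range (Complex.exp ∘ z))) ℂ)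
          (insert (1 : ℂ) (range z))) : Cardinal) +
      trdeg ℚ (adjoin ℚ (range (Complex.exp ∘ z))) :=
  bakerOverL_at_of_schanuel_at z (by simp)

/-! ### (a) Load-bearing hypothesis -/

/-- `BakerOverL` with the hypothesis `LinearIndependent ℚ z` dropped. -/
def BakerOverLWithoutLinIndep : Prop :=
  ∀ (n : ℕ) (z : Fin n → ℂ), ((n + 1 : ℕ) : Cardinal) ≤
    (Module.finrank (algebraicClosure (IntermediateField.adjoin ℚ (Set.range (Complex.exp ∘ z))) ℂ)
      (Submodule.span (algebraicClosure (IntermediateField.adjoin ℚ (Set.range (Complex.exp ∘ z))) ℂ)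
        (insert (1 : ℂ) (Set.range z))) : Cardinal) +
    Algebra.trdeg ℚ (IntermediateField.adjoin ℚ (Set.range (Complex.exp ∘ z)))

/-- Any proof of `BakerOverL` must use `LinearIndependent ℚ z`: without it the statement fails at
`z = (1, 1)` (`d = 1`, `b = trdeg ℚ(e) ≤ 1`, `3 ≰ 2`). [folklore] -/
theorem bakerOverL_false_without_linIndep : ¬ BakerOverLWithoutLinIndep := by
  intro h
  have h1 := h 2 (fun _ => 1)
  set K := IntermediateField.adjoin ℚ (Set.range (Complex.exp ∘ fun _ : Fin 2 => (1 : ℂ))) with hK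
  have hb : trdeg ℚ K ≤ 1 := by
    refine (trdeg_adjoin_le_mk _).trans ?_
    calc #(Set.range (Complex.exp ∘ fun _ : Fin 2 => (1 : ℂ)))
        ≤ #({Complex.exp 1} : Set ℂ) := Cardinal.mk_le_mk_of_subset (by rintro _ ⟨i, rfl⟩; simp)
      _ = 1 := Cardinal.mk_singleton _
  have hd : Module.finrank (algebraicClosure K ℂ) (Submodule.span (algebraicClosure K ℂ)
      (insert (1 : ℂ) (Set.range fun _ : Fin 2 => (1 : ℂ)))) ≤ 1 := by
    calc _ ≤ Module.finrank (algebraicClosure K ℂ)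
          (Submodule.span (algebraicClosure K ℂ) ({1} : Set ℂ)) :=
          Submodule.finrank_mono (Submodule.span_mono (Set.insert_subset_iff.2
            ⟨Set.mem_singleton 1, by rintro _ ⟨i, rfl⟩; exact Set.mem_singleton 1⟩))
      _ = 1 := finrank_span_singleton one_ne_zero
  have e : ((1 + 1 : ℕ) : Cardinal) = 1 + 1 := by rw [Nat.cast_add, Nat.cast_one]
  have h3 : ((2 + 1 : ℕ) : Cardinal) ≤ ((1 + 1 : ℕ) : Cardinal) :=
    h1.trans ((add_le_add (by exact_mod_cast hd) hb).trans_eq e.symm)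
  exact absurd (Nat.cast_le.1 h3) (by omega)

/-- Vacuity check: the hypothesis of `BakerOverL` is satisfiable (`z = (1)`). -/
example : LinearIndependent ℚ (fun _ : Fin 1 => (1 : ℂ)) :=
  linearIndependent_unique_iff.2 one_ne_zero

end Summit.Schanuel.Schanuel.Cruxes.BakerOverL.Disproof
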